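import Literature.Probability.LatticeModels.FKFreeArcPhase
import Literature.Probability.LatticeModels.LatticeDobrushinBox
import Literature.Probability.LatticeModels.FermionicObservableSums
import Summits.CriticalPhenomena.CardyFormulaZ2.Theorems.CardyComplexConeDefs
import Summits.CriticalPhenomena.CardyFormulaZ2.Theorems.CardyComplexConeCoherentMoreraKirchhoffSignedHopf

/-!
# Deterministic boundary winding at the free wall of the three-sided box
(line `qkz-strip-boundary-arm` of crux `CardyComplexCone.EdgePrecompact`, stmt-CriticalPhenomena-11387;
necessity certificate "UniformInnerEnvelope ⇒ cube-root half-plane one-arm bound", piece N4,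
registered sub-goal `threeSided_turnCount_wallDart`)

Setting: the three-sided box `LatticeDobrushin.threeSided W H` (sites `[0, W] × [-1, H]`, wired on its
left column, top row and right column; the bottom row `[0, W] × {-1}` is the free arc `B`), one
configuration `ω` read in the completed configuration `β = E.bcBondConfig ω` of
`E = (threeSided W H).toDobrushin`, the start corner `c₀ = ((0, 0), 3)` and the cut orbit
`cornerOrbit β c₀ 0, …, N - 1` up to the exit time `N` (= the medial exploration path).

**Theorem `threeSided_turnCount_wallDart`.** If the east-going wall dart `d = ((x, 0), 3)`,
`0 < x < W`, is the `k`-th dart of the exploration, `k < N`, then the signed number of quarter turns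
of the exploration from `c₀` to `d` vanishes: `turnCount β c₀ k = 0`.

Proof. Both `c₀` and `d` point down to the free arc. The tree's `FKFreeArcPhase` closes the
perturbed polygon of the interface prefix `c₀ … d` below the free arc (at height `-1/2`) into a
simple closed polygon whose exterior angles sum to `(π/2) · turnCount - 2π`
(`FreeArcPhase.sum_extAngle_cyc`), whence `turnCount ∈ {0, 8}` by Hopf's Umlaufsatz
(`FreeArcPhase.turnCount_eq_zero_or_eight`: enough for the spin-`1/2` phase, which only sees the
turning modulo `8`). The SIGN is pinned by the signed Umlaufsatz at a lowest vertex
(`sum_extAngle_eq_neg_two_pi_of_isLowest_of_neg`, Theorems file `…CoherentMoreraKirchhoffSignedHopf`):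
the closing vertex `D₁ = (x + 1/8, -1/2)` is a lowest vertex of the polygon (the prefix stays at
height `≥ -3/8`) and the polygon turns right there (`FreeArcPhase.extAngle_D₁ = -π/2`), so the total
turning is `-2π` and `turnCount = 0`.

References: H. Duminil-Copin, C. Hongler, P. Nolin, Comm. Pure Appl. Math. 64 (2011), §4, proof of
Lemma 12 ("since `e` is along the free arc, the winding of the exploration path at `e` is constant");
H. Hopf, Compositio Math. 2 (1935), Satz I.
-/

namespace Summit.CriticalPhenomena.CardyFormulaZ2.Cruxes.EdgePrecompact.QkzStripBoundaryArm

open MeasureTheory Filter Set Metric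
open scoped Topology BigOperators Pointwise
open Literature.Probability.LatticeModels Literature.Probability.Percolation
open Literature.Probability.RandomPlanarGeometry (DobrushinDomain)
open Summit.CriticalPhenomena.CardyFormulaZ2.Theses.CardyComplexCone
open Literature.Topology.PlaneTopology (extAngle)
open Summit.CriticalPhenomena.CardyFormulaZ2.Cruxes.CoherentMorera.FinitaryGreenPairing
  (sum_extAngle_eq_neg_two_pi_of_isLowest_of_neg)

noncomputable section

section ThreeSided

open LatticeDobrushin

variable {W H : ℕ}

/-- **The start corner of the three-sided box** is `((0, 0), 3)` (for any admissibility witness,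
`W ≥ 1`): the `A`–`B` edge below the bottom-left wired corner, oriented downwards, has the inner face
`(0, -1)` on its left and the non-inner face `(-1, -1)` on its right; uniqueness of the start corner
(`existsUnique_startCorner`). -/
private theorem startCorner_threeSided_N4 (hE : (threeSided W H).toDobrushin.IsZdAdmissible) (hW : 1 ≤ W) :
    DiscreteDobrushin.startCorner hE = FreeArcPhase.c₀ 0 := by
  have h1 := DiscreteDobrushin.isStartCorner_startCorner hE
  refine (DiscreteDobrushin.existsUnique_startCorner hE).unique ⟨h1.mem_zdArcA, h1.mem_zdArcB, h1.isOutEdge⟩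
    ⟨?_, ?_, ?_, ?_⟩
  · rw [FreeArcPhase.c₀, zdArcA_threeSided, mem_threeSided_A]; simp
  · have e : (![(0 : ℤ), 0] : Site 2) + cornerUnit 3 = ![0, -1] := by
      funext i; fin_cases i <;> simp [cornerUnit]
    rw [FreeArcPhase.c₀, e, zdArcB_threeSided]; simp
  · rw [FreeArcPhase.c₀, isInnerFace_threeSided_iff]; simp [faceAt, cornerOff]; omega
  · rw [FreeArcPhase.c₀, isInnerFace_threeSided_iff]; simp [faceAt, cornerOff]

/-- Off the bottom row, the sites of the three-sided box have nonnegative height. -/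
private theorem height_nonneg_threeSided_N4 {v : Site 2}
    (hv : v ∈ meshDomain (threeSided W H).toDobrushin.Ω (threeSided W H).toDobrushin.δ)
    (hvB : v ∉ (threeSided W H).toDobrushin.zdArcB) : 0 ≤ v 1 := by
  rw [(threeSided W H).meshDomain_eq, mem_threeSided_S] at hv
  rw [zdArcB_threeSided] at hvB
  simp only [Set.mem_setOf_eq, not_and] at hvB
  have := hvB hv.1 hv.2.1
  omega

end ThreeSided

/-- **Every vertex of the closed polygon lies at height `≥ -1/2`**: the prefix pieces stay at height
`≥ -3/8` (`FreeArcPhase.im_ge_of_mem_prefix`), the two closing vertices `D₁`, `D₂` sit at `-1/2`. -/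
private theorem im_vert_ge_N4 {β : BondConfig (Site 2)} {L X : ℤ} {j : ℕ} (hyp : FreeArcPhase.Hyp β L X j)
    (m : ℕ) : -(1 / 2 : ℝ) ≤ (FreeArcPhase.vert β L X j m).im := by
  unfold FreeArcPhase.vert
  split_ifs with h1 h2
  · have hj := hyp.one_le
    rcases h1.lt_or_eq with h | h
    · have := FreeArcPhase.im_ge_of_mem_prefix hyp h (left_mem_segment ℝ _ _)
      linarith
    · have := FreeArcPhase.im_ge_of_mem_prefix hyp (a := 2 * j - 1) (by omega)
        (by rw [show 2 * j - 1 + 1 = m by omega]; exact right_mem_segment ℝ _ _)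
      linarith
  · simp [FreeArcPhase.D₁]
  · simp [FreeArcPhase.D₂]

/-- **The closing vertex `D₁` is a lowest vertex of the closed polygon.** -/
private theorem isLowest_D₁_N4 {β : BondConfig (Site 2)} {L X : ℤ} {j : ℕ} (hyp : FreeArcPhase.Hyp β L X j)
    (i : ℤ) : (FreeArcPhase.cyc β L X j ((2 * j + 1 : ℕ) : ℤ)).im ≤ (FreeArcPhase.cyc β L X j i).im := by
  rw [FreeArcPhase.cyc_two_j_add_one]
  have h := im_vert_ge_N4 hyp ((i % ((2 * j + 3 : ℕ) : ℤ)).toNat)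
  simp only [FreeArcPhase.D₁]
  exact h

/-- **The winding at a free-arc dart vanishes** (signed form of `FreeArcPhase.turnCount_eq_zero_or_eight`):
under the hypotheses `FreeArcPhase.Hyp` of the closing argument, `turnCount β (c₀ L) j = 0`. The closed
polygon turns right (`-π/2`) at its lowest vertex `D₁`, so its total turning
`(π/2) · turnCount - 2π` is `-2π` by the signed Umlaufsatz. -/
private theorem turnCount_eq_zero_of_hyp_N4 {β : BondConfig (Site 2)} {L X : ℤ} {j : ℕ}
    (hyp : FreeArcPhase.Hyp β L X j) : turnCount β (FreeArcPhase.c₀ L) j = 0 := by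
  have hneg : extAngle (FreeArcPhase.cyc β L X j) ((2 * j + 1 : ℕ) : ℤ) < 0 := by
    rw [FreeArcPhase.extAngle_D₁ hyp]
    linarith [Real.pi_pos]
  have key := sum_extAngle_eq_neg_two_pi_of_isLowest_of_neg (FreeArcPhase.isSimplePolygon_cyc hyp)
    (isLowest_D₁_N4 hyp) hneg
  rw [FreeArcPhase.sum_extAngle_cyc hyp] at key
  have h' : Real.pi / 2 * (turnCount β (FreeArcPhase.c₀ L) j : ℝ) = Real.pi / 2 * 0 := by linarith
  exact_mod_cast mul_left_cancel₀ (by positivity) h'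

/-- **Deterministic boundary winding at the free wall of the three-sided box** (necessity certificate,
piece N4). In the three-sided box `threeSided W H` with admissible realisation `E`, for every
configuration `ω` and every `0 < x < W`: if the east-going wall dart `((x, 0), 3)` is the `k`-th dart of
the cut orbit of the start corner, `k` before the exit time, then `turnCount (E.bcBondConfig ω) c₀ k = 0`
— the exploration arrives at every free-wall dart with zero net turning (DCHN 2011, proof of Lemma 12,
in signed form: the closed-up interface prefix is a simple polygon turning right at its lowest vertex,
so Hopf's signed Umlaufsatz gives total turning `-2π = (π/2) · turnCount - 2π`). -/
theorem threeSided_turnCount_wallDart : ∀ (W H : ℕ) (hE : (LatticeDobrushin.threeSided W H).toDobrushin.IsZdAdmissible) (ω : BondConfig (Site 2)) (x k : ℕ), 1 ≤ x → x + 1 ≤ W → k < DiscreteDobrushin.exitTime hE ω → cornerOrbit ((LatticeDobrushin.threeSided W H).toDobrushin.bcBondConfig ω) (DiscreteDobrushin.startCorner hE) k = (![(x : ℤ), 0], 3) → turnCount ((LatticeDobrushin.threeSided W H).toDobrushin.bcBondConfig ω) (DiscreteDobrushin.startCorner hE) k = 0 := by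
  intro W H hE ω x k hx1 hxW hk horb
  have hc₀ : DiscreteDobrushin.startCorner hE = FreeArcPhase.c₀ 0 := startCorner_threeSided_N4 hE (by omega)
  rw [hc₀] at horb ⊢
  have hB : (![(x : ℤ), -1] : Site 2) ∈ (LatticeDobrushin.threeSided W H).toDobrushin.zdArcB := by
    rw [LatticeDobrushin.zdArcB_threeSided, Set.mem_setOf_eq]
    simp; omega
  exact turnCount_eq_zero_of_hyp_N4 (FreeArcPhase.hyp_of_domain hE hc₀ (by exact_mod_cast hx1)
    (fun v hv hvB => height_nonneg_threeSided_N4 hv hvB) hB ω hk horb)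

end

end Summit.CriticalPhenomena.CardyFormulaZ2.Cruxes.EdgePrecompact.QkzStripBoundaryArm
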